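/-
Copyright (c) 2026 the pub-hodgecm-mathlib formalisation cell (harness21).  Prover seat hodgecm-mathlib-K2E4-p14 (g5), Track B ∕ K2-LIT, h413 =
`stmt-HodgeConjecture-24833`, line `K2_E1_TraceFormulaBeta`, campaign «EIS-RANK-ONE» rung R6f(ii); DEAL «EIS-R6f-ii» `K2E1MaassSelbergU` of the dealer K2E1-plan (g3)
2026-09-04T05:13:55Z (road «B»: boundedness only), FILE 1∕2: the FOUR-BRACKET ALGEBRA of the Maass–Selberg relation, hypothesis-first.
-/
import Literature.NumberTheory.Automorphic.UnitaryGroupBorelCosetSumUnfoldingBochnerFin   -- ★ every-rank Bochner coset unfolding `∫_X Σ'_q ψ(q̃ x̃⁻¹) = c_μ ∫ (β g).toReal • ψ g`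
import Summits.HodgeConjecture.HodgeConjecture.Theorems.K2E1TruncatedEisensteinExplicit  -- ★ p857445 (K2E1-p09 g4) R6b: `Λ^T E(f) = E(𝟙_{H≤T} f) − E(𝟙_{T<H} Mf)`
import Literature.NumberTheory.Automorphic.UnitaryGroupKernelClassOrbitalUnfolding        -- ★ `isHaarMeasure_count_quotientSubgroup_quasiSplit`, discreteness of `G(F)` (ED. 2)
import Literature.NumberTheory.Automorphic.UnitaryGroupQuasiSplitWeilMeasure              -- ★ `unfoldingConstant_pos_of_isAutomorphicMeasure` (ED. 2)
import HarnessLib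

/-!
# K2·E1 — `K2E1MaassSelbergFourBrackets`: `⟨Λ^T E f, Λ^T E f′⟩ = [𝟙_{≤T} f, f′] + [𝟙_{≤T} f, M f′] − [𝟙_{>T} M f, f′] − [𝟙_{>T} M f, M f′]`
# (campaign «EIS-RANK-ONE», rung R6f(ii), file 1∕2: the algebra of the rank-one Maass–Selberg relation, every analytic input hypothesis-first)

Track B ∕ K2-LIT, crux h413 = `stmt-HodgeConjecture-24833`, route of record `HCCMUnconditional`; cell `hodgecm-mathlib`, squad K2, ENGINE E1.  Prover seat
`hodgecm-mathlib-K2E4-p14` (g5); DEAL «EIS-R6f-ii» of the dealer K2E1-plan (g3) 2026-09-04T05:13:55Z (SPEC `SPEC-EIS-R6-MaassSelberg` §2′, road «B»: «boundedness only — no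
decay rate, no self-adjointness of `Λ^T` needed»).  THEOREMS ONLY (no `def`, no `instance`, no notation, no named-fact hypothesis, no `sorry`); lane `--supports
stmt-HodgeConjecture-24833 --as helper` (count-neutral).  Closes no socket.  File 2∕2 (`K2E1MaassSelbergU`: the bracket evaluations through ★ (δ) + ★ p857517 and the relation on
the sub-tube) imports this file.

THE MATHEMATICS (steps (1)–(6) of the dealer's road «B» [MoeglinWaldspurger1995, IV.2.1–IV.2.3; Arthur1980TraceFormulaII, §4; Garrett2018, §11.3]).  `G = U(J_N)(𝔸_F)`, `X = G(𝔸)∕G(F)`,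
`β` a covering weight of `B(F)♯`, `[A, B]_β := ∫_{G(𝔸)} β(g) · A(g) · conj B(g) dν_G` ("`∫_{B(F)∖G(𝔸)} A · conj B`"), `H` the Borel height, `T ≥ 1`, `ψ := 𝟙_{H ≤ T}·f − 𝟙_{T < H}·M f`.
* §1 (pure Bochner algebra over ANY measure space; the intertwining operators `M`, `M′` abstract): **`integral_weight_psi_mul_conj_eq_four_brackets`** — IF (AVG) `[ψ, Λ′]_β =
  [ψ, CT Λ′]_β` (averaging over `N(F)∖N(𝔸)`, p09's export), (CT′) `CT Λ′ = 𝟙_{H ≤ T}·(f′ + M f′) − M(𝟙_{T<H}·(f′ + M f′))` (two-piece constant term of `Λ^T E f′`, ★ R3 + ★ R6b∕c),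
  (ADJ) `[ψ, M χ]_β = [M′ ψ, χ]_β` for `χ = 𝟙_{T<H}·(f′ + M f′)` (p09's `intertwining_adjoint`), (R6a) `M′ ψ = M f` on `{T < H}` (★ p857424∕p857469), and the five integrands are
  integrable, THEN **`[ψ, Λ′]_β = [𝟙_{≤T} f, f′]_β + [𝟙_{≤T} f, M f′]_β − [𝟙_{>T} M f, f′]_β − [𝟙_{>T} M f, M f′]_β`** (the cross term `𝟙_{>T} M f · conj 𝟙_{≤T}(…)` vanishes
  pointwise).
* §0 (NEXT EDITION of this file, append-only — from `X` to `B(F)∖G(𝔸)`, `U(J_N)` every `N`): `∫_X Λ^T E(f)(x̃⁻¹) · conj Λ′(x̃⁻¹) dμ = c_μ · [ψ, Λ′]_β` for a bounded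
  left-`G(F)`-invariant Borel `Λ′` (the truncated `E f′` of ★ R6e p857514): ★ R6b `truncation_eisensteinSeriesU_eq` makes `Λ^T E(f) = E(ψ)` POINTWISE (hypotheses `hSiegel`, `hCT`,
  `hsum`), `E(ψ)(g) · conj Λ′(g) = Σ'_q (ψ · conj Λ′)(γ̃_q g)` by `G(F)`-invariance of `Λ′`, and ★ BochnerFin unfolds the signed coset sum (`∫⁻ β ‖ψ‖ₑ < ∞` + `‖Λ′‖ ≤ M₁`).
HONEST LABEL: HC_CM is proved only modulo the 7 printed citations (2 remaining named inputs: hLiu418 = `stmt-HodgeConjecture-24832`, h413 = `stmt-HodgeConjecture-24833`) until rung 0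
closes; this file asserts no named fact and closes no socket.
References: [MoeglinWaldspurger1995] C. Mœglin, J.-L. Waldspurger, *Spectral Decomposition and Eisenstein Series* (1995), IV.2.1–IV.2.3 · [Arthur1980TraceFormulaII] J. Arthur, *A trace
formula for reductive groups II*, Compositio Math. 40 (1980), §4 · [Garrett2018] P. Garrett, *Modern Analysis of Automorphic Forms by Example* (2018), §1.11, §2.11, §11.3.
-/

set_option autoImplicit false
-- the mandated namespace repeats the single-problem summit's segment (`HodgeConjecture.HodgeConjecture`)
set_option linter.dupNamespace false

noncomputable section

open MeasureTheory Measure NumberField IsDedekindDomain Set MulAction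
open scoped ENNReal NNReal ComplexConjugate
open Literature.MeasureTheory.Group Literature.NumberTheory
open Literature.NumberTheory.Automorphic Literature.NumberTheory.Automorphic.UnitaryGroup
open Summit.HodgeConjecture.HodgeConjecture.Cruxes.H413.K2E1BorelEisensteinU

namespace Summit.HodgeConjecture.HodgeConjecture.Cruxes.H413.K2E1MaassSelbergFourBrackets

/-! ## §1 The four-bracket algebra (any measure space; `M`, `M′` abstract) -/

section Algebra

variable {G : Type*}

/-- Pointwise: `ψ · conj (𝟙_{≤T}(f′ + M f′)) = 𝟙_{≤T} f · conj f′ + 𝟙_{≤T} f · conj M f′` — on `{H ≤ T}` one has `ψ = f`, off it the left factor `𝟙_{≤T}(…)` vanishes. [folklore] -/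
theorem psi_mul_conj_indicator_le (H : G → ℝ≥0) (T : ℝ≥0) (f Mf f' Mf' : G → ℂ) (g : G) :
    ({x | H x ≤ T}.indicator f g - {x | T < H x}.indicator Mf g) * conj ({x | H x ≤ T}.indicator (f' + Mf') g) =
      {x | H x ≤ T}.indicator f g * conj (f' g) + {x | H x ≤ T}.indicator f g * conj (Mf' g) := by
  by_cases hg : H g ≤ T
  · have hg' : ¬ T < H g := not_lt.2 hg
    rw [indicator_of_mem (show g ∈ {x | H x ≤ T} from hg), indicator_of_mem (show g ∈ {x | H x ≤ T} from hg),
      indicator_of_notMem (show g ∉ {x | T < H x} from hg'), sub_zero, Pi.add_apply, map_add, mul_add]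
  · rw [indicator_of_notMem (show g ∉ {x | H x ≤ T} from hg), indicator_of_notMem (show g ∉ {x | H x ≤ T} from hg), map_zero,
      mul_zero, zero_mul, zero_mul, add_zero]

/-- Pointwise: if `M′ψ = M f` on `{T < H}`, then `M′ψ · conj (𝟙_{T<H}(f′ + M f′)) = 𝟙_{T<H} M f · conj f′ + 𝟙_{T<H} M f · conj M f′`. [folklore] -/
theorem adjointPsi_mul_conj_indicator_lt (H : G → ℝ≥0) (T : ℝ≥0) (Mf f' Mf' M'ψ : G → ℂ) (hM'ψ : ∀ g, T < H g → M'ψ g = Mf g) (g : G) :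
    M'ψ g * conj ({x | T < H x}.indicator (f' + Mf') g) =
      {x | T < H x}.indicator Mf g * conj (f' g) + {x | T < H x}.indicator Mf g * conj (Mf' g) := by
  by_cases hg : T < H g
  · rw [indicator_of_mem (show g ∈ {x | T < H x} from hg), indicator_of_mem (show g ∈ {x | T < H x} from hg), hM'ψ g hg, Pi.add_apply,
      map_add, mul_add]
  · rw [indicator_of_notMem (show g ∉ {x | T < H x} from hg), indicator_of_notMem (show g ∉ {x | T < H x} from hg), map_zero,
      mul_zero, zero_mul, zero_mul, add_zero]

/-- **THE FOUR-BRACKET ALGEBRA OF THE MAASS–SELBERG RELATION** (road «B», steps (3)–(6); any measure space `(G, ν)`, any weight `β`, abstract height `H`, cut-off `T`, sections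
`f, f′`, intertwined sections `M f, M f′`, truncated second series `Λ′`, its constant term `CT Λ′`, and ABSTRACT intertwining operators `M`, `M′`).  With
`ψ = 𝟙_{H ≤ T}·f − 𝟙_{T<H}·M f`, `χ = 𝟙_{T<H}·(f′ + M f′)` and `[A, B] = ∫ β·A·conj B dν`: IF (AVG) `[ψ, Λ′] = [ψ, CT Λ′]`, (CT′) `CT Λ′ = 𝟙_{H≤T}·(f′ + M f′) − M χ`,
(ADJ) `[ψ, M χ] = [M′ψ, χ]`, (R6a) `M′ψ = M f` on `{T < H}`, and the five integrands below are integrable, THEN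
**`[ψ, Λ′] = [𝟙_{≤T} f, f′] + [𝟙_{≤T} f, M f′] − [𝟙_{>T} M f, f′] − [𝟙_{>T} M f, M f′]`**.
[cite: MoeglinWaldspurger1995, IV.2.1–IV.2.3] [cite: Arthur1980TraceFormulaII, §4] [cite: Garrett2018, §11.3] -/
theorem integral_weight_psi_mul_conj_eq_four_brackets [MeasurableSpace G] (ν : Measure G) (β : G → ℝ≥0∞) (H : G → ℝ≥0) (T : ℝ≥0)
    (f Mf f' Mf' Λ' CT' : G → ℂ) (M M' : (G → ℂ) → (G → ℂ))
    (hAVG : ∫ g, (β g).toReal • (({x | H x ≤ T}.indicator f g - {x | T < H x}.indicator Mf g) * conj (Λ' g)) ∂ν =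
      ∫ g, (β g).toReal • (({x | H x ≤ T}.indicator f g - {x | T < H x}.indicator Mf g) * conj (CT' g)) ∂ν)
    (hCT' : ∀ g, CT' g = {x | H x ≤ T}.indicator (f' + Mf') g - M ({x | T < H x}.indicator (f' + Mf')) g)
    (hadj : ∫ g, (β g).toReal • (({x | H x ≤ T}.indicator f g - {x | T < H x}.indicator Mf g) * conj (M ({x | T < H x}.indicator (f' + Mf')) g)) ∂ν =
      ∫ g, (β g).toReal • (M' (fun x => {x | H x ≤ T}.indicator f x - {x | T < H x}.indicator Mf x) g * conj ({x | T < H x}.indicator (f' + Mf') g)) ∂ν)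
    (hM'ψ : ∀ g, T < H g → M' (fun x => {x | H x ≤ T}.indicator f x - {x | T < H x}.indicator Mf x) g = Mf g)
    (hi₁ : Integrable (fun g => (β g).toReal • ({x | H x ≤ T}.indicator f g * conj (f' g))) ν)
    (hi₂ : Integrable (fun g => (β g).toReal • ({x | H x ≤ T}.indicator f g * conj (Mf' g))) ν)
    (hi₃ : Integrable (fun g => (β g).toReal • ({x | T < H x}.indicator Mf g * conj (f' g))) ν)
    (hi₄ : Integrable (fun g => (β g).toReal • ({x | T < H x}.indicator Mf g * conj (Mf' g))) ν)
    (hi₅ : Integrable (fun g => (β g).toReal • (({x | H x ≤ T}.indicator f g - {x | T < H x}.indicator Mf g) *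
      conj (M ({x | T < H x}.indicator (f' + Mf')) g))) ν) :
    ∫ g, (β g).toReal • (({x | H x ≤ T}.indicator f g - {x | T < H x}.indicator Mf g) * conj (Λ' g)) ∂ν =
      ∫ g, (β g).toReal • ({x | H x ≤ T}.indicator f g * conj (f' g)) ∂ν
        + ∫ g, (β g).toReal • ({x | H x ≤ T}.indicator f g * conj (Mf' g)) ∂ν
        - ∫ g, (β g).toReal • ({x | T < H x}.indicator Mf g * conj (f' g)) ∂ν
        - ∫ g, (β g).toReal • ({x | T < H x}.indicator Mf g * conj (Mf' g)) ∂ν := by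
  -- (3)+(4): average and insert the two-piece constant term, then split
  have hfirst : ∫ g, (β g).toReal • (({x | H x ≤ T}.indicator f g - {x | T < H x}.indicator Mf g) * conj ({x | H x ≤ T}.indicator (f' + Mf') g)) ∂ν =
      ∫ g, (β g).toReal • ({x | H x ≤ T}.indicator f g * conj (f' g)) ∂ν + ∫ g, (β g).toReal • ({x | H x ≤ T}.indicator f g * conj (Mf' g)) ∂ν := by
    rw [← integral_add hi₁ hi₂]
    refine integral_congr_ae (Filter.Eventually.of_forall fun g => ?_)
    dsimp only
    rw [psi_mul_conj_indicator_le, smul_add]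
  -- (5): adjoint, then `M′ψ = M f` on `{T < H}`
  have hsecond : ∫ g, (β g).toReal • (({x | H x ≤ T}.indicator f g - {x | T < H x}.indicator Mf g) * conj (M ({x | T < H x}.indicator (f' + Mf')) g)) ∂ν =
      ∫ g, (β g).toReal • ({x | T < H x}.indicator Mf g * conj (f' g)) ∂ν + ∫ g, (β g).toReal • ({x | T < H x}.indicator Mf g * conj (Mf' g)) ∂ν := by
    rw [hadj, ← integral_add hi₃ hi₄]
    refine integral_congr_ae (Filter.Eventually.of_forall fun g => ?_)
    dsimp only
    rw [adjointPsi_mul_conj_indicator_lt H T Mf f' Mf' _ hM'ψ, smul_add]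
  have hi12 : Integrable (fun g => (β g).toReal • (({x | H x ≤ T}.indicator f g - {x | T < H x}.indicator Mf g) *
      conj ({x | H x ≤ T}.indicator (f' + Mf') g))) ν := by
    refine (hi₁.add hi₂).congr (Filter.Eventually.of_forall fun g => ?_)
    simp only [Pi.add_apply]
    rw [psi_mul_conj_indicator_le, smul_add]
  calc ∫ g, (β g).toReal • (({x | H x ≤ T}.indicator f g - {x | T < H x}.indicator Mf g) * conj (Λ' g)) ∂ν
      = ∫ g, (β g).toReal • (({x | H x ≤ T}.indicator f g - {x | T < H x}.indicator Mf g) * conj (CT' g)) ∂ν := hAVG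
    _ = ∫ g, ((β g).toReal • (({x | H x ≤ T}.indicator f g - {x | T < H x}.indicator Mf g) * conj ({x | H x ≤ T}.indicator (f' + Mf') g))
          - (β g).toReal • (({x | H x ≤ T}.indicator f g - {x | T < H x}.indicator Mf g) * conj (M ({x | T < H x}.indicator (f' + Mf')) g))) ∂ν := by
        refine integral_congr_ae (Filter.Eventually.of_forall fun g => ?_)
        dsimp only
        rw [hCT' g, map_sub, mul_sub, smul_sub]
    _ = _ := by rw [integral_sub hi12 hi₅, hfirst, hsecond]; ring

end Algebra


/-! ## §0 (ED. 2) From `X = G(𝔸)∕G(F)` to the `B(F)`-weight level: `⟨Λ^T E f, Λ′⟩_X = c_μ · [ψ, Λ′]_β` (`U(J_N)`, every `N`) -/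

section Unfold

open AdelicGroupData
open Summit.HodgeConjecture.HodgeConjecture.Cruxes.H413.K2E1BorelCosetsDictionary
open Summit.HodgeConjecture.HodgeConjecture.Cruxes.H413.K2E1TruncatedEisensteinExplicit

variable {F E : Type} [Field F] [NumberField F] [Field E] [NumberField E] [Algebra F E] {c : E ≃ₐ[F] E} {N : ℕ} [NeZero N]
variable [MeasurableSpace (quasiSplit F E c N).Adelic] [BorelSpace (quasiSplit F E c N).Adelic]
variable [MeasurableSpace (adelicUnipotent F E c N)]

omit [MeasurableSpace (adelicUnipotent F E c N)] in
/-- The truncation integrand `ψ = 𝟙_{H ≤ T}·f − 𝟙_{T<H}·Mf` times `conj Λ′` is Borel and left-`B(F)`-invariant when `f`, `Mf` are Borel left-`B(F)`-invariant and `Λ′` is Borel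
left-`G(F)`-invariant (height cut-offs are `B(F)`-stable: ★ `forall_arithmeticBorel_indicator`). [cite: Garrett2018, §2.10] -/
theorem measurable_and_invariant_psi_mul_conj {T : ℝ≥0} {f Mf Λ' : (quasiSplit F E c N).Adelic → ℂ} (hfm : Measurable f) (hMfm : Measurable Mf)
    (hf : ∀ b ∈ arithmeticBorel F E c N, ∀ x : (quasiSplit F E c N).Adelic, f ((b : (quasiSplit F E c N).Adelic) * x) = f x)
    (hMf : ∀ b ∈ arithmeticBorel F E c N, ∀ x : (quasiSplit F E c N).Adelic, Mf ((b : (quasiSplit F E c N).Adelic) * x) = Mf x)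
    (hΛm : Measurable Λ') (hΛG : ∀ (γ : (quasiSplit F E c N).arithmeticSubgroup) (x : (quasiSplit F E c N).Adelic), Λ' ((γ : (quasiSplit F E c N).Adelic) * x) = Λ' x) :
    Measurable (fun g => ({y : (quasiSplit F E c N).Adelic | borelHeight y ≤ T}.indicator f g - {y : (quasiSplit F E c N).Adelic | T < borelHeight y}.indicator Mf g) *
        conj (Λ' g)) ∧
      ∀ b ∈ arithmeticBorel F E c N, ∀ x : (quasiSplit F E c N).Adelic,
        ({y : (quasiSplit F E c N).Adelic | borelHeight y ≤ T}.indicator f ((b : (quasiSplit F E c N).Adelic) * x) -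
            {y : (quasiSplit F E c N).Adelic | T < borelHeight y}.indicator Mf ((b : (quasiSplit F E c N).Adelic) * x)) *
          conj (Λ' ((b : (quasiSplit F E c N).Adelic) * x)) =
        ({y : (quasiSplit F E c N).Adelic | borelHeight y ≤ T}.indicator f x - {y : (quasiSplit F E c N).Adelic | T < borelHeight y}.indicator Mf x) * conj (Λ' x) := by
  refine ⟨?_, fun b hb x => ?_⟩
  · have hle : MeasurableSet {y : (quasiSplit F E c N).Adelic | borelHeight y ≤ T} := (isClosed_setOf_borelHeight_le T).measurableSet
    have hlt : MeasurableSet {y : (quasiSplit F E c N).Adelic | T < borelHeight y} := measurableSet_lt measurable_const measurable_borelHeight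
    exact ((hfm.indicator hle).sub (hMfm.indicator hlt)).mul (Complex.continuous_conj.measurable.comp hΛm)
  · rw [forall_arithmeticBorel_indicator hf (fun h => h ≤ T) b hb x, forall_arithmeticBorel_indicator hMf (fun h => T < h) b hb x, hΛG b x]

/-- **FROM `X` TO THE `B(F)`-WEIGHT LEVEL** (road «B», steps (1)–(2); `U(J_N)`, every `N`, `F`-rank one through `hSiegel`).  `μ` an automorphic measure on `X = G(𝔸)∕G(F)`, `ν_G` an
inversion-invariant Haar measure on `G(𝔸)`: there is ONE constant `c_μ > 0` (Weil's unfolding constant ★ `unfoldingConstant`, the same as ★ BochnerFin) such that for every covering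
weight `β` of `B(F)♯`, every `T ≥ 1`, every Borel left-`B(F)`-invariant `f`, `M f` with `E(f)_B = f + M f` on `{H > T}` (`hCT`) and `E(f)` convergent (`hsum`), and every BOUNDED Borel
left-`G(F)`-invariant `Λ′` (the truncated second Eisenstein series of ★ R6e p857514) with `∫⁻ β ‖ψ‖ₑ dν_G < ∞`, `ψ = 𝟙_{H ≤ T}·f − 𝟙_{T<H}·M f`:
`x ↦ Λ^T E(f)(x̃⁻¹) · conj Λ′(x̃⁻¹)` is `μ`-integrable and **`∫_X quotFun (Λ^T E f) · conj (quotFun Λ′) dμ = c_μ · ∫_{G(𝔸)} β(g) • (ψ(g) · conj Λ′(g)) dν_G`** — ★ R6b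
`truncation_eisensteinSeriesU_eq` pointwise (`Λ^T E(f) = E(𝟙_{≤T} f) − E(𝟙_{>T} M f)`), both cut-off sums in Track A's index (★ `eisensteinSeriesU_eq_tsum_arithmeticBorelQuot`; the
`{>T}` one finitely supported ★ `finite_support_indicator_out_mul`), `conj Λ′(g) = conj Λ′(γ̃_q g)`, and ★ BochnerFin on `ψ · conj Λ′`.
[cite: MoeglinWaldspurger1995, IV.2.1–IV.2.3] [cite: Garrett2018, §1.11 and §11.3] [cite: Arthur1980TraceFormulaII, §4] -/
theorem exists_integral_quotFun_truncation_mul_conj_eq_mul_integral_weight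
    (hSiegel : ∀ γ : (quasiSplit F E c N).arithmeticSubgroup, γ ∉ arithmeticBorel F E c N →
      ∀ g : (quasiSplit F E c N).Adelic, borelHeight ((γ : (quasiSplit F E c N).Adelic) * g) * borelHeight g ≤ 1)
    (μ : Measure (quasiSplit F E c N).automorphicQuotient) [(quasiSplit F E c N).IsAutomorphicMeasure μ]
    (νG : Measure (quasiSplit F E c N).Adelic) [νG.IsHaarMeasure] [νG.IsInvInvariant] :
    ∃ cμ : ℝ, 0 < cμ ∧
      ∀ {β : (quasiSplit F E c N).Adelic → ℝ≥0∞}, IsCoveringWeight ((arithmeticBorel F E c N).map (quasiSplit F E c N).arithmeticSubgroup.subtype) β →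
      ∀ {ν : Measure (adelicUnipotent F E c N)} {𝓕 : Set (adelicUnipotent F E c N)} {T : ℝ≥0}, 1 ≤ T →
      ∀ {f Mf Λ' : (quasiSplit F E c N).Adelic → ℂ}, Measurable f → Measurable Mf →
        (∀ b ∈ arithmeticBorel F E c N, ∀ x : (quasiSplit F E c N).Adelic, f ((b : (quasiSplit F E c N).Adelic) * x) = f x) →
        (∀ b ∈ arithmeticBorel F E c N, ∀ x : (quasiSplit F E c N).Adelic, Mf ((b : (quasiSplit F E c N).Adelic) * x) = Mf x) →
        (∀ x : (quasiSplit F E c N).Adelic, T < borelHeight x → borelConstantTerm ν 𝓕 (eisensteinSeriesU f) x = f x + Mf x) →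
        (∀ g : (quasiSplit F E c N).Adelic,
          Summable fun q : Quotient (orbitRel ↥(borelU (c : E →+* E) ((StdForm.antidiagonal N).over E)) ↥(unitaryGroupOfForm (c : E →+* E) ((StdForm.antidiagonal N).over E))) =>
            f ((quasiSplit F E c N).toAdelic (q.out : ↥(unitaryGroupOfForm (c : E →+* E) ((StdForm.antidiagonal N).over E))) * g)) →
        Measurable Λ' → (∀ (γ : (quasiSplit F E c N).arithmeticSubgroup) (x : (quasiSplit F E c N).Adelic), Λ' ((γ : (quasiSplit F E c N).Adelic) * x) = Λ' x) →
        ∀ {M₁ : ℝ}, (∀ g, ‖Λ' g‖ ≤ M₁) →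
        ∫⁻ g, β g * ‖{y : (quasiSplit F E c N).Adelic | borelHeight y ≤ T}.indicator f g - {y : (quasiSplit F E c N).Adelic | T < borelHeight y}.indicator Mf g‖ₑ ∂νG < ∞ →
        Integrable (fun x : (quasiSplit F E c N).automorphicQuotient =>
            (quasiSplit F E c N).quotFun (truncation ν 𝓕 T (eisensteinSeriesU f)) x * conj ((quasiSplit F E c N).quotFun Λ' x)) μ ∧
          ∫ x, (quasiSplit F E c N).quotFun (truncation ν 𝓕 T (eisensteinSeriesU f)) x * conj ((quasiSplit F E c N).quotFun Λ' x) ∂μ =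
            (cμ : ℂ) * ∫ g, (β g).toReal • (({y : (quasiSplit F E c N).Adelic | borelHeight y ≤ T}.indicator f g -
              {y : (quasiSplit F E c N).Adelic | T < borelHeight y}.indicator Mf g) * conj (Λ' g)) ∂νG := by
  classical
  -- structure on `G(𝔸)` and Weil's constant (as in ★ BochnerFin ∕ ★ p857542)
  haveI := t2Space_adeleRing_of_numberField E
  haveI := locallyCompactSpace_adeleRing' E
  haveI := secondCountableTopology_adeleRing E
  haveI : T2Space (quasiSplit F E c N).Adelic := inferInstanceAs (T2Space (adelic F E c N ((StdForm.antidiagonal N).over E)))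
  haveI : LocallyCompactSpace (quasiSplit F E c N).Adelic := inferInstanceAs (LocallyCompactSpace (adelic F E c N ((StdForm.antidiagonal N).over E)))
  haveI : SecondCountableTopology (quasiSplit F E c N).Adelic := inferInstanceAs (SecondCountableTopology (adelic F E c N ((StdForm.antidiagonal N).over E)))
  haveI : DiscreteTopology (quasiSplit F E c N).quotientSubgroup := discreteTopology_quotientSubgroup_quasiSplit
  haveI : Countable (quasiSplit F E c N).quotientSubgroup := by
    rw [quotientSubgroup_quasiSplit]; exact countable_arithmeticSubgroup_quasiSplit
  haveI : (count : Measure (quasiSplit F E c N).quotientSubgroup).IsHaarMeasure := isHaarMeasure_count_quotientSubgroup_quasiSplit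
  letI := AdelicGroupData.measurableSpaceQuotientForm (quasiSplit F E c N)
  haveI := AdelicGroupData.borelSpaceQuotientForm (quasiSplit F E c N)
  haveI := AdelicGroupData.smulInvariantMeasureQuotientForm (quasiSplit F E c N) μ
  haveI := AdelicGroupData.isFiniteMeasureOnCompactsQuotientForm (quasiSplit F E c N) μ
  have hcμ : 0 < unfoldingConstant (quasiSplit F E c N).quotientSubgroup (count : Measure (quasiSplit F E c N).quotientSubgroup) μ νG :=
    AdelicGroupData.unfoldingConstant_pos_of_isAutomorphicMeasure _ isClosed_quotientSubgroup_quasiSplit count μ νG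
  refine ⟨(unfoldingConstant (quasiSplit F E c N).quotientSubgroup (count : Measure (quasiSplit F E c N).quotientSubgroup) μ νG : ℝ), NNReal.coe_pos.2 hcμ,
    fun {β} hβ {ν} {𝓕} {T} hT {f} {Mf} {Λ'} hfm hMfm hf hMf hCT hsum hΛm hΛG {M₁} hΛbdd hψL1 => ?_⟩
  -- the integrand `Ψ = ψ · conj Λ′`
  obtain ⟨hΨm, hΨB⟩ := measurable_and_invariant_psi_mul_conj (T := T) hfm hMfm hf hMf hΛm hΛG
  have hint : ∫⁻ g, β g * ‖({y : (quasiSplit F E c N).Adelic | borelHeight y ≤ T}.indicator f g - {y : (quasiSplit F E c N).Adelic | T < borelHeight y}.indicator Mf g) *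
      conj (Λ' g)‖ₑ ∂νG < ∞ := by
    have hM : ∀ g, ‖conj (Λ' g)‖ₑ ≤ ENNReal.ofReal M₁ := fun g => by
      rw [← ofReal_norm, Complex.norm_conj]; exact ENNReal.ofReal_le_ofReal (hΛbdd g)
    calc ∫⁻ g, β g * ‖({y : (quasiSplit F E c N).Adelic | borelHeight y ≤ T}.indicator f g - {y : (quasiSplit F E c N).Adelic | T < borelHeight y}.indicator Mf g) *
          conj (Λ' g)‖ₑ ∂νG
        ≤ ∫⁻ g, β g * ‖{y : (quasiSplit F E c N).Adelic | borelHeight y ≤ T}.indicator f g - {y : (quasiSplit F E c N).Adelic | T < borelHeight y}.indicator Mf g‖ₑ *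
            ENNReal.ofReal M₁ ∂νG := lintegral_mono fun g => by rw [enorm_mul, ← mul_assoc]; gcongr; exact hM g
      _ = (∫⁻ g, β g * ‖{y : (quasiSplit F E c N).Adelic | borelHeight y ≤ T}.indicator f g - {y : (quasiSplit F E c N).Adelic | T < borelHeight y}.indicator Mf g‖ₑ ∂νG) *
            ENNReal.ofReal M₁ := lintegral_mul_const' _ _ ENNReal.ofReal_ne_top
      _ < ∞ := ENNReal.mul_lt_top hψL1 ENNReal.ofReal_lt_top
  obtain ⟨hI, hE⟩ := integrable_tsum_borelQuotient_and_integral_eq_mul_integral_fin μ νG hβ hΨm hΨB hint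
  -- pointwise on `X`: `Λ^T E(f)(x̃⁻¹) · conj Λ′(x̃⁻¹) = Σ'_q (ψ · conj Λ′)(γ̃_q x̃⁻¹)`
  have hfI := forall_arithmeticBorel_indicator hf fun h => h ≤ T
  have hMI := forall_arithmeticBorel_indicator hMf fun h => T < h
  have hpt : ∀ g : (quasiSplit F E c N).Adelic, truncation ν 𝓕 T (eisensteinSeriesU f) g * conj (Λ' g) =
      ∑' q : Quotient (QuotientGroup.rightRel (arithmeticBorel F E c N)),
        ({y : (quasiSplit F E c N).Adelic | borelHeight y ≤ T}.indicator f (((q.out : (quasiSplit F E c N).arithmeticSubgroup) : (quasiSplit F E c N).Adelic) * g) -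
            {y : (quasiSplit F E c N).Adelic | T < borelHeight y}.indicator Mf (((q.out : (quasiSplit F E c N).arithmeticSubgroup) : (quasiSplit F E c N).Adelic) * g)) *
          conj (Λ' (((q.out : (quasiSplit F E c N).arithmeticSubgroup) : (quasiSplit F E c N).Adelic) * g)) := by
    intro g
    have hsumA := summable_arithmeticBorelQuot_of_summable hf (hsum g)
    have hsum_le : Summable fun q : Quotient (QuotientGroup.rightRel (arithmeticBorel F E c N)) =>
        {y : (quasiSplit F E c N).Adelic | borelHeight y ≤ T}.indicator f (((q.out : (quasiSplit F E c N).arithmeticSubgroup) : (quasiSplit F E c N).Adelic) * g) := by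
      have h : (fun q : Quotient (QuotientGroup.rightRel (arithmeticBorel F E c N)) =>
          {y : (quasiSplit F E c N).Adelic | borelHeight y ≤ T}.indicator f (((q.out : (quasiSplit F E c N).arithmeticSubgroup) : (quasiSplit F E c N).Adelic) * g)) =
          {q : Quotient (QuotientGroup.rightRel (arithmeticBorel F E c N)) |
            borelHeight (((q.out : (quasiSplit F E c N).arithmeticSubgroup) : (quasiSplit F E c N).Adelic) * g) ≤ T}.indicator
            fun q => f (((q.out : (quasiSplit F E c N).arithmeticSubgroup) : (quasiSplit F E c N).Adelic) * g) := by
        funext q; simp only [Set.indicator_apply, Set.mem_setOf_eq]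
      rw [h]; exact hsumA.indicator _
    have hsum_gt : Summable fun q : Quotient (QuotientGroup.rightRel (arithmeticBorel F E c N)) =>
        {y : (quasiSplit F E c N).Adelic | T < borelHeight y}.indicator Mf (((q.out : (quasiSplit F E c N).arithmeticSubgroup) : (quasiSplit F E c N).Adelic) * g) :=
      summable_of_hasFiniteSupport (finite_support_indicator_out_mul hSiegel hT Mf g)
    rw [truncation_eisensteinSeriesU_eq hSiegel hT hf hMf hCT (hsum g), eisensteinSeriesU_eq_tsum_arithmeticBorelQuot hfI g,
      eisensteinSeriesU_eq_tsum_arithmeticBorelQuot hMI g, ← hsum_le.tsum_sub hsum_gt, ← tsum_mul_right]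
    exact tsum_congr fun q => by rw [hΛG]
  have hptX : ∀ x : (quasiSplit F E c N).automorphicQuotient,
      (quasiSplit F E c N).quotFun (truncation ν 𝓕 T (eisensteinSeriesU f)) x * conj ((quasiSplit F E c N).quotFun Λ' x) =
        ∑' q : Quotient (QuotientGroup.rightRel (arithmeticBorel F E c N)),
          ({y : (quasiSplit F E c N).Adelic | borelHeight y ≤ T}.indicator f (((q.out : (quasiSplit F E c N).arithmeticSubgroup) : (quasiSplit F E c N).Adelic) *
              (Quotient.out x : (quasiSplit F E c N).Adelic)⁻¹) -
            {y : (quasiSplit F E c N).Adelic | T < borelHeight y}.indicator Mf (((q.out : (quasiSplit F E c N).arithmeticSubgroup) : (quasiSplit F E c N).Adelic) *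
              (Quotient.out x : (quasiSplit F E c N).Adelic)⁻¹)) *
          conj (Λ' (((q.out : (quasiSplit F E c N).arithmeticSubgroup) : (quasiSplit F E c N).Adelic) * (Quotient.out x : (quasiSplit F E c N).Adelic)⁻¹)) :=
    fun x => hpt _
  refine ⟨hI.congr (ae_of_all _ fun x => (hptX x).symm), ?_⟩
  rw [integral_congr_ae (ae_of_all _ hptX), hE]

end Unfold

end Summit.HodgeConjecture.HodgeConjecture.Cruxes.H413.K2E1MaassSelbergFourBrackets

end
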